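import Summits.Ventures.Crystal3D.Theorems.StickyWulffConstantCoaxialWallLawModuleContacts
import Summits.Ventures.Crystal3D.Theorems.StickyWulffConstantCoaxialWallLawEndRowCoaxialModuleDefs
import HarnessLib

/-!
# FOUR BARLOW CONTACTS FORCE A MODULE POINT: the geometric statement (crux `CoaxialWallLaw`, stmt-Ventures-19481, line `WallLedgerF`;
# rigidity lemma of the line of `stub_multiGrainSmallHigh`)

HONEST FRAMING. Venture `Summits/Ventures/Crystal3D` (cell `crystal3d-full`), helper `--supports` the crux `CoaxialWallLaw` of
`route-Ventures-StickyWulffConstant` (REGISTERED line `WallLedgerF`, skeleton 'CoaxialWallLawCertificates' v4, stub `stub_multiGrainSmallHigh`).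
Rung credit only; F-C1 not moved; census-free.  Sequel of `…ModuleContacts` (kernel table + real bridge + `exists_menu_core` in integer module
coordinates): the statement about BARLOW WINDOWS.  Module coordinates of a point `w`: `(2w₀, 2√3 w₁, √6 w₂)`; the site `barlowPos 1 √(2/3) s k a b`
has INTEGER coordinates `(2a + b + L_k, 3b + L_k, 2k)` (`L_k = haggLabel s k`), `12·dist² = Q(Δ)`, and two sites of one Hägg stacking are
Barlow-consistent (`haggLabel_succ`, `IsHaggSeq`).
* `twelve_mul_dist_sq` — `12·dist(v,w)² = 3ΔA² + ΔB² + 2ΔC²` in module coordinates; `coords_barlowPos`; `barlowPair_barlowPos`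
  (sites of one Hägg stacking are pairwise Barlow-consistent); `mem_coaxialModule_of_coords` (integer module coordinates ⇒ module point);
* **`mem_coaxialModule_of_four_barlow_contacts`** — for a placement `w ↦ S w + z` and a Hägg sequence `s`: if four points of the placed stacking
  `S·(barlowStacking 1 √(2/3) s) + z`, pairwise at distance `≥ 1`, are all at distance `1` from `x`, then `S⁻¹(x − z)` is a point of the coaxial
  module — i.e. **a ball OFF the module of a Barlow window touches at most three of its balls** (`card_barlow_contacts_le_three`), so a dust payer
  jammed against a Barlow window with no other dust has degree `≤ 3` and is under the line by `TailResidue.multiGrainSmallLow_three`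
  (family (A2) of memo F-TAIL-g10 §9(d); (C2′) of §10).
WHAT THIS IS NOT: not the stub; F-C1 not moved.
-/

noncomputable section

namespace Summit.Ventures.Crystal3D.Theorems

namespace ModuleContacts

open Summit.Ventures.Crystal3D Finset
open LatticeContacts (dotR)
open Literature.MathematicalPhysics.StatisticalMechanics (barlowPos barlowStacking haggLabel haggLabel_succ IsHaggSeq triangularVec₁
  triangularVec₂ barlowOffset layerNormal barlowPos_apply_zero barlowPos_apply_one barlowPos_apply_two)
open scoped InnerProductSpace

/-! ### Module coordinates of points -/

/-- first module coordinate `2w₀` -/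
def mA (w : EuclideanSpace ℝ (Fin 3)) : ℝ := 2 * w 0
/-- second module coordinate `2√3 w₁` -/
def mB (w : EuclideanSpace ℝ (Fin 3)) : ℝ := 2 * Real.sqrt 3 * w 1
/-- third module coordinate `√6 w₂` -/
def mC (w : EuclideanSpace ℝ (Fin 3)) : ℝ := Real.sqrt 6 * w 2

/-- `12·dist² = 3ΔA² + ΔB² + 2ΔC²`. -/
theorem twelve_mul_dist_sq (v w : EuclideanSpace ℝ (Fin 3)) :
    12 * dist v w ^ 2 = 3 * (mA v - mA w) ^ 2 + (mB v - mB w) ^ 2 + 2 * (mC v - mC w) ^ 2 := by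
  have h3 : Real.sqrt 3 ^ 2 = 3 := Real.sq_sqrt (by norm_num)
  have h6 : Real.sqrt 6 ^ 2 = 6 := Real.sq_sqrt (by norm_num)
  rw [EuclideanSpace.dist_eq, Real.sq_sqrt (Finset.sum_nonneg fun i _ => sq_nonneg _)]
  simp only [Fin.sum_univ_three, mA, mB, mC, Real.dist_eq, sq_abs]
  nlinarith [h3, h6]

/-- **Module coordinates of a Barlow site**: `(2a + b + L_k, 3b + L_k, 2k)`. -/
theorem coords_barlowPos (s : ℤ → ℤ) (k a b : ℤ) :
    mA (barlowPos 1 (Real.sqrt (2 / 3)) s k a b) = ((2 * a + b + haggLabel s k : ℤ) : ℝ) ∧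
    mB (barlowPos 1 (Real.sqrt (2 / 3)) s k a b) = ((3 * b + haggLabel s k : ℤ) : ℝ) ∧
    mC (barlowPos 1 (Real.sqrt (2 / 3)) s k a b) = ((2 * k : ℤ) : ℝ) := by
  have h3 : Real.sqrt 3 * Real.sqrt 3 = 3 := Real.mul_self_sqrt (by norm_num)
  have e26 : Real.sqrt 6 * Real.sqrt (2 / 3) = 2 := by
    rw [← Real.sqrt_mul (by norm_num : (0 : ℝ) ≤ 6), show (6 : ℝ) * (2 / 3) = 2 ^ 2 by norm_num, Real.sqrt_sq (by norm_num)]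
  refine ⟨?_, ?_, ?_⟩
  · simp only [mA, barlowPos_apply_zero]; push_cast; ring
  · simp only [mB, barlowPos_apply_one]; push_cast
    linear_combination ((b : ℝ) + (haggLabel s k : ℝ) / 3) * h3
  · simp only [mC, barlowPos_apply_two]; push_cast
    linear_combination ((k : ℝ)) * e26

/-- Consecutive labels of a Hägg stacking differ by `±1`. -/
theorem haggLabel_succ_cases {s : ℤ → ℤ} (hs : IsHaggSeq s) (k : ℤ) :
    haggLabel s (k + 1) - haggLabel s k = 1 ∨ haggLabel s (k + 1) - haggLabel s k = -1 := by
  rw [haggLabel_succ]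
  rcases hs k with h | h <;> rw [h]
  · left; ring
  · right; ring

/-- **Two sites of one Hägg stacking are Barlow-consistent** (in translated integer module coordinates). -/
theorem barlowPair_barlowPos {s : ℤ → ℤ} (hs : IsHaggSeq s) (k a b k' a' b' : ℤ) (r : V3) :
    barlowPair (subZ (2 * a + b + haggLabel s k, 3 * b + haggLabel s k, 2 * k) r)
      (subZ (2 * a' + b' + haggLabel s k', 3 * b' + haggLabel s k', 2 * k') r) = true := by
  rw [barlowPair_true_iff]
  simp only [subZ]
  constructor
  · intro h
    have hk : k' = k := by omega
    subst hk
    omega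
  · intro h
    rcases h with h | h
    · have hk : k' = k + 1 := by omega
      subst hk
      rcases haggLabel_succ_cases hs k with h1 | h1 <;> omega
    · have hk : k = k' + 1 := by omega
      subst hk
      rcases haggLabel_succ_cases hs k' with h1 | h1 <;> omega

/-- **Integer module coordinates give a module point.** -/
theorem mem_coaxialModule_of_coords (w : EuclideanSpace ℝ (Fin 3)) (A B C : ℤ) (hpar : (A - B) % 2 = 0) (hC : C % 2 = 0)
    (h0 : mA w = A) (h1 : mB w = B) (h2 : mC w = C) : w ∈ coaxialModule 1 (Real.sqrt (2 / 3)) := by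
  obtain ⟨i, hi⟩ : ∃ i : ℤ, A - B = 2 * i := ⟨(A - B) / 2, by omega⟩
  obtain ⟨k, hk⟩ : ∃ k : ℤ, C = 2 * k := ⟨C / 2, by omega⟩
  refine ⟨i, 0, B, k, ?_⟩
  have h3 : Real.sqrt 3 * Real.sqrt 3 = 3 := Real.mul_self_sqrt (by norm_num)
  have h3pos : 0 < Real.sqrt 3 := Real.sqrt_pos.2 (by norm_num)
  have h6pos : 0 < Real.sqrt 6 := Real.sqrt_pos.2 (by norm_num)
  have e26 : Real.sqrt 6 * Real.sqrt (2 / 3) = 2 := by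
    rw [← Real.sqrt_mul (by norm_num : (0 : ℝ) ≤ 6), show (6 : ℝ) * (2 / 3) = 2 ^ 2 by norm_num, Real.sqrt_sq (by norm_num)]
  simp only [mA, mB, mC] at h0 h1 h2
  have hiR : ((A : ℝ)) - B = 2 * i := by exact_mod_cast hi
  have hkR : ((C : ℝ)) = 2 * k := by exact_mod_cast hk
  ext l
  fin_cases l
  · simp [triangularVec₁, triangularVec₂, barlowOffset, layerNormal]
    linarith
  · simp [triangularVec₁, triangularVec₂, barlowOffset, layerNormal]
    have e : Real.sqrt 3 * (2 * Real.sqrt 3 * w 1) = Real.sqrt 3 * B := by rw [h1]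
    have : w 1 = (B : ℝ) * Real.sqrt 3 / 6 := by
      linear_combination (1 / 6 : ℝ) * e - (w 1 / 3) * h3
    rw [this]; ring
  · simp [triangularVec₁, triangularVec₂, barlowOffset, layerNormal]
    have : w 2 = (k : ℝ) * Real.sqrt (2 / 3) := by
      have : Real.sqrt 6 * w 2 = Real.sqrt 6 * ((k : ℝ) * Real.sqrt (2 / 3)) := by
        rw [h2, hkR, mul_left_comm, e26]; ring
      exact mul_left_cancel₀ h6pos.ne' this
    have hsd : Real.sqrt (2 / 3) = Real.sqrt 2 * (Real.sqrt 3)⁻¹ := by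
      rw [Real.sqrt_div (show (0 : ℝ) ≤ 2 by norm_num), div_eq_mul_inv]
    rw [this, hsd]
    ring

/-! ### The theorem -/

/-- **FOUR BARLOW CONTACTS FORCE A MODULE POINT.**  For a placement `w ↦ S w + z` of a Barlow stacking (`s` a Hägg sequence): if four points
`p 0, …, p 3` with `S⁻¹(p i − z)` sites of the stacking, pairwise at distance `≥ 1`, are all at distance `1` from `x`, then `S⁻¹(x − z)` is a point
of the coaxial module. -/
theorem mem_coaxialModule_of_four_barlow_contacts (S : EuclideanSpace ℝ (Fin 3) ≃ₗᵢ[ℝ] EuclideanSpace ℝ (Fin 3))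
    (z : EuclideanSpace ℝ (Fin 3)) {s : ℤ → ℤ} (hs : IsHaggSeq s) (x : EuclideanSpace ℝ (Fin 3)) (p : Fin 4 → EuclideanSpace ℝ (Fin 3))
    (hmem : ∀ i, S.symm (p i - z) ∈ barlowStacking 1 (Real.sqrt (2 / 3)) s)
    (hsep : ∀ i j, i ≠ j → 1 ≤ dist (p i) (p j)) (hd : ∀ i, dist x (p i) = 1) :
    S.symm (x - z) ∈ coaxialModule 1 (Real.sqrt (2 / 3)) := by
  -- the sites and their integer module coordinates
  choose k a b hkab using fun i => (hmem i)
  set y : Fin 4 → EuclideanSpace ℝ (Fin 3) := fun i => S.symm (p i - z) with hy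
  set x' := S.symm (x - z) with hx'
  have hdist_xy : ∀ i, dist x' (y i) = 1 := fun i => by
    rw [hx', hy, dist_eq_norm, ← map_sub, LinearIsometryEquiv.norm_map, sub_sub_sub_cancel_right, ← dist_eq_norm]; exact hd i
  have hdist_yy : ∀ i j, i ≠ j → 1 ≤ dist (y i) (y j) := fun i j hij => by
    rw [hy, dist_eq_norm, ← map_sub, LinearIsometryEquiv.norm_map, sub_sub_sub_cancel_right, ← dist_eq_norm]; exact hsep i j hij
  -- integer coordinates `cA i, cB i, cC i`
  set cA : Fin 4 → ℤ := fun i => 2 * a i + b i + haggLabel s (k i) with hcA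
  set cB : Fin 4 → ℤ := fun i => 3 * b i + haggLabel s (k i) with hcB
  set cC : Fin 4 → ℤ := fun i => 2 * k i with hcC
  have hco : ∀ i, mA (y i) = (cA i : ℝ) ∧ mB (y i) = (cB i : ℝ) ∧ mC (y i) = (cC i : ℝ) := fun i => by
    have h := coords_barlowPos s (k i) (a i) (b i)
    rw [← hkab i] at h
    exact h
  -- the translated data: `u = M(x') − M(y 0)`, `m i = c i − c 0`
  set u0 := mA x' - cA 0 with hu0
  set u1 := mB x' - cB 0 with hu1
  set u2 := mC x' - cC 0 with hu2
  set m : Fin 4 → V3 := fun i => subZ (cA i, cB i, cC i) (cA 0, cB 0, cC 0) with hm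
  have hsphere : 3 * u0 ^ 2 + u1 ^ 2 + 2 * u2 ^ 2 = 12 := by
    have h := twelve_mul_dist_sq x' (y 0)
    rw [hdist_xy 0, (hco 0).1, (hco 0).2.1, (hco 0).2.2] at h
    rw [hu0, hu1, hu2]; linarith
  have heqn : ∀ i, 2 * dotR u0 u1 u2 (rowZ (m i)) = (QZ (m i) : ℝ) := fun i => by
    have h := twelve_mul_dist_sq x' (y i)
    rw [hdist_xy i, (hco i).1, (hco i).2.1, (hco i).2.2] at h
    simp only [hm, dotR, rowZ, QZ, subZ]; push_cast
    rw [hu0, hu1, hu2]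
    nlinarith [hsphere, h]
  have hsepZ : ∀ i j, i ≠ j → 12 ≤ QZ (subZ (m i) (m j)) := fun i j hij => by
    have h := twelve_mul_dist_sq (y i) (y j)
    rw [(hco i).1, (hco i).2.1, (hco i).2.2, (hco j).1, (hco j).2.1, (hco j).2.2] at h
    have h1 := hdist_yy i j hij
    have hR : (12 : ℝ) ≤ ((QZ (subZ (m i) (m j)) : ℤ) : ℝ) := by
      simp only [hm, QZ, subZ]; push_cast
      nlinarith [h, h1, dist_nonneg (x := y i) (y := y j)]
    exact_mod_cast hR
  have hm0 : m 0 = (0, 0, 0) := by simp [hm, subZ]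
  have hsep0 : ∀ i, i ≠ 0 → 12 ≤ QZ (m i) := fun i hi => by
    have h := hsepZ i 0 hi
    rwa [hm0, show subZ (m i) (0, 0, 0) = m i by simp [subZ]] at h
  have hpar : ∀ i, ((m i).1 - (m i).2.1) % 2 = 0 ∧ (m i).2.2 % 2 = 0 := fun i => by
    simp only [hm, subZ, hcA, hcB, hcC]; omega
  have hbar : ∀ i j, barlowPair (m i) (m j) = true := fun i j => by
    simp only [hm, hcA, hcB, hcC]
    exact barlowPair_barlowPos hs (k i) (a i) (b i) (k j) (a j) (b j) _
  -- the core theorem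
  obtain ⟨σ, hσ, e0, e1, e2⟩ := exists_menu_core hsphere (hpar 1) (hpar 2) (hpar 3)
    (hsep0 1 (by decide)) (hsep0 2 (by decide)) (hsep0 3 (by decide))
    (hsepZ 1 2 (by decide)) (hsepZ 1 3 (by decide)) (hsepZ 2 3 (by decide))
    (by rw [← hm0]; exact hbar 0 1) (by rw [← hm0]; exact hbar 0 2) (by rw [← hm0]; exact hbar 0 3)
    (hbar 1 2) (hbar 1 3) (hbar 2 3) (heqn 1) (heqn 2) (heqn 3)
  -- back to the point: integer module coordinates of `x'`
  obtain ⟨hσpar, hσC⟩ := S18_mod σ hσ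
  refine mem_coaxialModule_of_coords x' (σ.1 + cA 0) (σ.2.1 + cB 0) (σ.2.2 + cC 0) ?_ ?_ ?_ ?_ ?_
  · have := (hpar 1).1; simp only [hcA, hcB]; omega
  · simp only [hcC]; omega
  · push_cast; rw [← e0, hu0]; ring
  · push_cast; rw [← e1, hu1]; ring
  · push_cast; rw [← e2, hu2]; ring

open scoped Classical in
/-- **A BALL OFF THE MODULE OF A BARLOW WINDOW TOUCHES AT MOST THREE OF ITS BALLS.**  For a placement `w ↦ S w + z`, a Hägg sequence `s` and a
`1`-separated configuration `X`: if `S⁻¹(x − z)` is NOT a module point, then at most three balls of `X` lying on the placed stacking are at distance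
`1` from `x`. -/
theorem card_barlow_contacts_le_three (S : EuclideanSpace ℝ (Fin 3) ≃ₗᵢ[ℝ] EuclideanSpace ℝ (Fin 3)) (z : EuclideanSpace ℝ (Fin 3))
    {s : ℤ → ℤ} (hs : IsHaggSeq s) (X : Finset (EuclideanSpace ℝ (Fin 3))) (hX : ∀ p ∈ X, ∀ q ∈ X, p ≠ q → 1 ≤ dist p q)
    (x : EuclideanSpace ℝ (Fin 3)) (hx : S.symm (x - z) ∉ coaxialModule 1 (Real.sqrt (2 / 3))) :
    (X.filter fun u => S.symm (u - z) ∈ barlowStacking 1 (Real.sqrt (2 / 3)) s ∧ dist x u = 1).card ≤ 3 := by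
  by_contra hlt
  push Not at hlt
  set T := X.filter fun u => S.symm (u - z) ∈ barlowStacking 1 (Real.sqrt (2 / 3)) s ∧ dist x u = 1 with hT
  obtain ⟨U, hUT, hU⟩ := Finset.exists_subset_card_eq (show 4 ≤ T.card by omega)
  have e : U ≃ Fin 4 := Finset.equivFinOfCardEq hU
  let p : Fin 4 → EuclideanSpace ℝ (Fin 3) := fun i => (e.symm i).1
  have hpmem : ∀ i, p i ∈ T := fun i => hUT (e.symm i).2
  have hpinj : Function.Injective p := fun i j hij => by
    have : e.symm i = e.symm j := Subtype.ext hij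
    exact e.symm.injective this
  refine hx (mem_coaxialModule_of_four_barlow_contacts S z hs x p (fun i => (Finset.mem_filter.1 (hpmem i)).2.1)
    (fun i j hij => hX _ (Finset.mem_filter.1 (hpmem i)).1 _ (Finset.mem_filter.1 (hpmem j)).1 (fun h => hij (hpinj h)))
    (fun i => (Finset.mem_filter.1 (hpmem i)).2.2))

end ModuleContacts

end Summit.Ventures.Crystal3D.Theorems

end
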